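import Mathlib.NumberTheory.Chebyshev
import Mathlib.Analysis.Complex.ExponentialBounds
import Literature.NumberTheory.LFunctions.NicolasChainCheck
import Literature.NumberTheory.LFunctions.ThetaChainSound
import Literature.NumberTheory.LFunctions.NicolasCriterion
import Literature.Analysis.SpecialFunctions.EulerMascheroniBounds
import HarnessLib

/-!
# Nicolas's inequality at the primorials `p#`, `p < 599²`, by kernel computation: soundness of the checker
# (discharge of `Literature.NumberTheory.LFunctions.nicolas_iff`, Nicolas 1983, Thm. 2 (a))

Topic: `Literature/NumberTheory/LFunctions`. The semantic soundness of the Nicolas-chain checker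
`NicolasChainCheck.lean` over the complete prime table `ChainTable.table` (`ChainTableFacts.tableOK`):
if a chunk of the run succeeds, `runDN fuel s = some s'`, the **invariant** `Inv s` is transported to
`s'` (`runDN_sound`); the initial state satisfies it (`initN_inv`); and the invariant at a state with
prime `P` gives **Nicolas's inequality `e^γ log log(q#) < q#/φ(q#)` for every prime `q ≤ P`**
(`Inv.nic`). The kernel facts (the chunks of the run, to `P = 360649 > 599²`) are
`NicolasChainRun.lean`; the assembly with the analytic range is `NicolasCriterionProofs.lean`.

## The argument

* `Inv s` (for a state at the prime `p = s.p`): `p` is a table entry and prime; the enclosures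
  `Llo ≤ 2⁸⁰ log p ≤ Lhi`, `2⁸⁰ θ(p) ≤ Thi`, `P ≤ 2⁸⁰ Π(p)` with `Π(p) = ∏_{q ≤ p} q/(q−1) = p#/φ(p#)`
  (`piRatio`, `primorial_div_totient_eq_piRatio`); and Nicolas's inequality at `q#` for all primes
  `q ≤ p`.
* One step `p → p'` (`stepN_inv`): `p'` is the table successor of `p`, odd, and prime
  (`ThetaChain.primeChk_sound`); by completeness of the table there is no prime strictly between, so
  `θ(p') = θ(p) + log p'` (`ThetaChain.theta_succ_prime`) and `Π(p') = Π(p) · p'/(p'−1)`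
  (`piRatio_succ_prime`); `ThetaChain.logNext_sound` and `⌊P p'/(p'−1)⌋ ≤ P p'/(p'−1)` give the new
  enclosures; and `nicolasChk_sound`: the integer comparison `GHI·(Lhi'·p' + Thi') < (P'+GHI)·p'·2⁸⁰`
  with `GHI ≥ 2⁸⁰ e^γ` (`GHI_ge`, from the tree's `γ < 0.57721571` and Mathlib's `Real.exp_bound'`)
  says `e^γ (log p' + θ(p')/p' − 1) < Π(p')`, whence `e^γ log θ(p') < Π(p')` by
  `log θ ≤ log p' + θ/p' − 1` (`Real.log_le_sub_one_of_pos` applied to `θ(p')/p'`), i.e. Nicolas's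
  inequality at `p'#` (`log(p'#) = θ(p')`, `Chebyshev.theta_eq_log_primorial`).
* `initN_inv`: `θ(2) = log 2`, `Π(2) = 2`, and `e^γ log log 2 < 0 < 2 = 2/φ(2)`.

## References

* J.-L. Nicolas, *Petites valeurs de la fonction d'Euler*, J. Number Theory 17 (1983), 375–388,
  Thm. 2 (a). [Nicolas1983]
* J.-L. Nicolas, Acta Arith. 155 (2012), 311–321, (1.1) and Thm. 1.1 (1.7). [Nicolas2012]
-/

noncomputable section

namespace Literature.NumberTheory.LFunctions.NicolasChain

open ChainCheck ChainTable ThetaChain Real Finset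
open scoped Chebyshev

/-! ### `e^γ ≤ GHI/2⁸⁰` -/

/-- `e^γ < 1.7810726` (from `γ < 0.57721571` and ten terms of the exponential series).
[folklore] -/
private theorem exp_eulerMascheroni_lt_d7 : Real.exp Real.eulerMascheroniConstant < 1.7810726 := by
  have hγ := Literature.Analysis.SpecialFunctions.Real.eulerMascheroniConstant_lt_d8
  have h1 : Real.exp Real.eulerMascheroniConstant < Real.exp 0.57721571 := Real.exp_lt_exp.2 hγ
  have h2 := Real.exp_bound' (x := (0.57721571 : ℝ)) (by norm_num) (by norm_num) (n := 10)
    (by norm_num)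
  have h3 : (∑ m ∈ Finset.range 10, (0.57721571 : ℝ) ^ m / m.factorial) +
      (0.57721571 : ℝ) ^ 10 * (10 + 1) / (Nat.factorial 10 * 10) < 1.7810726 := by
    norm_num [Finset.sum_range_succ, Nat.factorial]
  push_cast at h2
  linarith

/-- **`GHI ≥ 2⁸⁰ e^γ`.** [folklore] -/
private theorem GHI_ge : 2 ^ 80 * Real.exp Real.eulerMascheroniConstant ≤ (GHI : ℝ) := by
  have h := exp_eulerMascheroni_lt_d7
  have h2 : (2 : ℝ) ^ 80 * 1.7810726 ≤ (GHI : ℝ) := by norm_num [GHI]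
  nlinarith

/-! ### The Euler-product ratio `Π(n) = ∏_{q ≤ n} q/(q−1) = n#/φ(n#)` -/

/-- `Π(n) = ∏_{q ≤ n, q prime} q/(q−1)`. [cite: Nicolas1983, §1 (N_k/φ(N_k) = ∏ (1 − 1/p)⁻¹)] -/
def piRatio (n : ℕ) : ℝ := ∏ q ∈ Nat.primesLE n, ((q : ℝ) / ((q : ℝ) - 1))

/-- `Π(n+1) = Π(n) · (n+1)/n` if `n+1` is prime, `= Π(n)` otherwise. [folklore] -/
private theorem piRatio_succ (n : ℕ) :
    piRatio (n + 1) = if (n + 1).Prime then piRatio n * (((n + 1 : ℕ) : ℝ) / (((n + 1 : ℕ) : ℝ) - 1))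
      else piRatio n := by
  unfold piRatio
  rw [Nat.primesLE_succ]
  split_ifs with h
  · rw [Finset.prod_insert (Nat.notMem_primesLE n), mul_comm]
  · rfl

/-- If there is no prime in `(p, n]` then `Π(n) = Π(p)`. [folklore] -/
private theorem piRatio_eq_of_noPrime {p : ℕ} : ∀ {n : ℕ}, p ≤ n → (∀ q : ℕ, p < q → q ≤ n → ¬ q.Prime) →
    piRatio n = piRatio p
  | 0, h, _ => by
      have : p = 0 := by omega
      subst this; rfl
  | n + 1, h, hq => by
      rcases Nat.eq_or_lt_of_le h with rfl | hlt
      · rfl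
      · rw [piRatio_succ, if_neg (hq (n + 1) (by omega) le_rfl)]
        exact piRatio_eq_of_noPrime (by omega) fun q h1 h2 => hq q h1 (by omega)

/-- If `p'` is prime and there is no prime in `(p, p')` then `Π(p') = Π(p) · p'/(p'−1)`. [folklore] -/
private theorem piRatio_succ_prime {p p' : ℕ} (hp' : p'.Prime) (hlt : p < p')
    (hq : ∀ q : ℕ, p < q → q < p' → ¬ q.Prime) :
    piRatio p' = piRatio p * ((p' : ℝ) / ((p' : ℝ) - 1)) := by
  obtain ⟨m, rfl⟩ : ∃ m, p' = m + 1 := ⟨p' - 1, by have := hp'.one_lt; omega⟩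
  rw [piRatio_succ, if_pos hp', piRatio_eq_of_noPrime (by omega) fun q h1 h2 => hq q h1 (by omega)]

/-- `Π(n) ≥ 1 > 0` (each factor `q/(q−1) ≥ 1`). [folklore] -/
private theorem one_le_piRatio (n : ℕ) : 1 ≤ piRatio n := by
  unfold piRatio
  refine Finset.prod_induction _ (fun x : ℝ => 1 ≤ x)
    (fun a b ha hb => one_le_mul_of_one_le_of_one_le ha hb) le_rfl fun q hq => ?_
  have hq2 : (2 : ℝ) ≤ q := by exact_mod_cast (Nat.prime_of_mem_primesLE hq).two_le
  rw [le_div_iff₀ (by linarith)]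
  linarith

/-- `Π(2) = 2`. [folklore] -/
private theorem piRatio_two : piRatio 2 = 2 := by
  unfold piRatio
  have hset : Nat.primesLE 2 = {2} := by decide
  rw [hset, Finset.prod_singleton]
  norm_num

/-- **`n#/φ(n#) = Π(n)`** (Euler's product for `φ` on the squarefree `n#`).
[cite: Nicolas1983, §1 (N_k/φ(N_k) = ∏ (1 − 1/p)⁻¹)] -/
theorem primorial_div_totient_eq_piRatio (n : ℕ) :
    (primorial n : ℝ) / Nat.totient (primorial n) = piRatio n := by
  have hφ := Nat.totient_eq_mul_prod_factors (primorial n)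
  have hφR : (Nat.totient (primorial n) : ℝ) =
      (primorial n : ℝ) * ∏ p ∈ Nat.primesLE n, (1 - (p : ℝ)⁻¹) := by
    have := congrArg (Rat.cast : ℚ → ℝ) hφ
    push_cast at this
    rw [primeFactors_primorial] at this
    exact this
  have hN0 : (primorial n : ℝ) ≠ 0 := by exact_mod_cast (primorial_pos n).ne'
  rw [hφR, div_mul_eq_div_div, div_self hN0, piRatio, one_div, ← Finset.prod_inv_distrib]
  refine Finset.prod_congr rfl fun q hq => ?_
  have hq0 : (q : ℝ) ≠ 0 := by exact_mod_cast (Nat.prime_of_mem_primesLE hq).ne_zero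
  field_simp

/-! ### Soundness of the comparison `nicolasChk` -/

/-- **Soundness of `nicolasChk`**: if the test passes and `2⁸⁰ log p ≤ Lhi`, `2⁸⁰ θ(p) ≤ Thi`,
`P ≤ 2⁸⁰ Π(p)` (`p ≥ 2`), then `e^γ log θ(p) < Π(p)` — since `log θ(p) ≤ log p + θ(p)/p − 1`.
[cite: Nicolas1983, Thm. 2 (a)] -/
theorem nicolasChk_sound {p Lhi Thi P : ℕ} (h : nicolasChk p Lhi Thi P = true) (hp : 2 ≤ p)
    (hL : 2 ^ 80 * Real.log p ≤ (Lhi : ℝ)) (hT : 2 ^ 80 * θ (p : ℝ) ≤ (Thi : ℝ))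
    (hP : (P : ℝ) ≤ 2 ^ 80 * piRatio p) :
    Real.exp Real.eulerMascheroniConstant * Real.log (θ (p : ℝ)) < piRatio p := by
  have hble : GHI * (Lhi * p + Thi) < (P + GHI) * p * SC := by
    simpa [nicolasChk, Nat.blt_eq, Nat.mul_eq, Nat.add_eq] using h
  have hR : (GHI : ℝ) * ((Lhi : ℝ) * p + Thi) < ((P : ℝ) + GHI) * p * 2 ^ 80 := by
    rw [← SC_real]; exact_mod_cast hble
  have hpR : (2 : ℝ) ≤ p := by exact_mod_cast hp
  have hp0 : (0 : ℝ) < p := by linarith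
  have hθ0 : 0 < θ (p : ℝ) := Chebyshev.theta_pos hpR
  have hG := GHI_ge
  have hG0 : (0 : ℝ) < GHI := by norm_num [GHI]
  have heγ : 0 < Real.exp Real.eulerMascheroniConstant := Real.exp_pos _
  have hPi := one_le_piRatio p
  -- `log θ(p) ≤ log p + θ(p)/p − 1`
  set M : ℝ := Real.log p + θ (p : ℝ) / p - 1 with hM
  have hlogθ : Real.log (θ (p : ℝ)) ≤ M := by
    have h1 : Real.log (θ (p : ℝ)) - Real.log p = Real.log (θ (p : ℝ) / p) :=
      (Real.log_div hθ0.ne' hp0.ne').symm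
    have h2 := Real.log_le_sub_one_of_pos (div_pos hθ0 hp0)
    rw [hM]; linarith
  -- the integer comparison says `GHI · M < P`, in units of `2⁸⁰`
  have hkey : (GHI : ℝ) * (2 ^ 80 * M) < (P : ℝ) * 2 ^ 80 := by
    have e1 : (GHI : ℝ) * (2 ^ 80 * M) * p =
        (GHI : ℝ) * ((2 ^ 80 * Real.log p) * p + 2 ^ 80 * θ (p : ℝ)) - (GHI : ℝ) * p * 2 ^ 80 := by
      rw [hM]; field_simp
    have e2 : (GHI : ℝ) * ((2 ^ 80 * Real.log p) * p + 2 ^ 80 * θ (p : ℝ)) ≤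
        (GHI : ℝ) * ((Lhi : ℝ) * p + Thi) := by
      apply mul_le_mul_of_nonneg_left _ hG0.le
      nlinarith
    have e3 : (GHI : ℝ) * (2 ^ 80 * M) * p < (P : ℝ) * 2 ^ 80 * p := by nlinarith
    exact lt_of_mul_lt_mul_right e3 hp0.le
  rcases le_or_gt 0 M with hM0 | hM0
  · -- `e^γ log θ ≤ e^γ M ≤ (GHI/2⁸⁰) M < P/2⁸⁰ ≤ Π`
    have h1 : Real.exp Real.eulerMascheroniConstant * Real.log (θ (p : ℝ)) ≤
        Real.exp Real.eulerMascheroniConstant * M := mul_le_mul_of_nonneg_left hlogθ heγ.le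
    have h2 : 2 ^ 80 * (Real.exp Real.eulerMascheroniConstant * M) ≤ (GHI : ℝ) * M := by
      nlinarith
    nlinarith
  · -- `e^γ log θ ≤ e^γ M < 0 < 1 ≤ Π`
    have h1 : Real.exp Real.eulerMascheroniConstant * Real.log (θ (p : ℝ)) < 0 := by
      have := mul_le_mul_of_nonneg_left hlogθ heγ.le
      nlinarith
    linarith

/-! ### The invariant -/

/-- **The invariant** of the Nicolas chain at a state. [cite: Nicolas1983, Thm. 2 (a)] -/
structure Inv (s : NS) : Prop where
  /-- the prime reached is a table entry -/
  mem : s.p ∈ table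
  /-- and is prime -/
  prime : s.p.Prime
  /-- `Llo ≤ 2⁸⁰ log p` -/
  Llo_le : (s.Llo : ℝ) ≤ 2 ^ 80 * Real.log s.p
  /-- `2⁸⁰ log p ≤ Lhi` -/
  le_Lhi : 2 ^ 80 * Real.log s.p ≤ s.Lhi
  /-- `2⁸⁰ θ(p) ≤ Thi` -/
  le_Thi : 2 ^ 80 * θ (s.p : ℝ) ≤ s.Thi
  /-- `P ≤ 2⁸⁰ Π(p)` -/
  P_le : (s.P : ℝ) ≤ 2 ^ 80 * piRatio s.p
  /-- Nicolas's inequality at `q#` for every prime `q ≤ p` -/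
  nic : ∀ q : ℕ, q.Prime → q ≤ s.p → nicolasInequality (primorial q)

/-- From `e^γ log θ(p) < Π(p)` to Nicolas's inequality at `p#` (`log(p#) = θ(p)`,
`p#/φ(p#) = Π(p)`). [cite: Nicolas1983, §1 (Thm. 2 ⟸ Thm. 3)] -/
theorem nicolasInequality_of_lt {p : ℕ}
    (h : Real.exp Real.eulerMascheroniConstant * Real.log (θ (p : ℝ)) < piRatio p) :
    nicolasInequality (primorial p) := by
  rw [nicolasInequality, primorial_div_totient_eq_piRatio]
  have hθ : θ (p : ℝ) = Real.log (primorial p) := by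
    rw [Chebyshev.theta_eq_log_primorial, Nat.floor_natCast]
  rw [← hθ]
  exact h

/-! ### One step -/

/-- A guard `bif c then X else none` that returns `some` passed its test. [folklore] -/
private theorem bif_some {α : Type} {c : Bool} {X : Option α} {a : α}
    (h : (bif c then X else none) = some a) : c = true ∧ X = some a := by
  cases c <;> simp_all

/-- **Soundness of one step.** If `Inv s` holds, `p'` is the table successor of `s.p`, and
`stepN s p' = some s'`, then `Inv s'` and `s'.p = p'`. [cite: Nicolas1983, Thm. 2 (a)] -/
theorem stepN_inv {s s' : NS} (hI : Inv s) {p' : ℕ} {rest : List ℕ}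
    (hafter : after s.p table = p' :: rest) (h : stepN s p' = some s') : Inv s' ∧ s'.p = p' := by
  have hT := tableOK
  obtain ⟨p, Llo, Lhi, Thi, P⟩ := s
  simp only at hafter hI
  obtain ⟨hmem, hprime, hLlo, hLhi, hThi, hPle, hnic⟩ := hI
  simp only at hmem hprime hLlo hLhi hThi hPle hnic
  -- the successor `p'`
  obtain ⟨hp'T, hpp', hmin⟩ := head_after hT.sorted hafter
  have hp'le : p' ≤ 4599989 := hT.bounded p' hp'T
  have hnoprime : ∀ q : ℕ, p < q → q < p' → ¬ q.Prime := fun q h1 h2 hq =>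
    absurd (hmin q (hT.complete q hq (by omega)) h1) (not_le.2 h2)
  have hp0 : 0 < p := hprime.pos
  -- unfold the step
  simp only [stepN, Nat.mul_eq, Nat.sub_eq, Nat.add_eq] at h
  obtain ⟨hg1, h⟩ := bif_not_none h
  simp only [Bool.and_eq_true] at hg1
  obtain ⟨⟨-, hodd⟩, hchk⟩ := hg1
  have hodd' : Odd p' := Nat.odd_iff.2 (Nat.eq_of_beq_eq_true hodd)
  have hp'prime : p'.Prime := primeChk_sound hchk hodd' (by omega)
  rcases hln : logNext p Llo Lhi p' with _ | ⟨Llo', Lhi'⟩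
  · rw [hln] at h; simp at h
  · rw [hln] at h
    simp only at h
    obtain ⟨hg3, h⟩ := bif_some h
    simp only [Option.some.injEq] at h
    subst h
    -- the new enclosures
    obtain ⟨hLlo', hLhi'⟩ := logNext_sound hln hp0 hpp'.le hLlo hLhi
    have hθ' : θ (p' : ℝ) = θ (p : ℝ) + Real.log p' := theta_succ_prime hp'prime hpp' hnoprime
    have hPi' : piRatio p' = piRatio p * ((p' : ℝ) / ((p' : ℝ) - 1)) :=
      piRatio_succ_prime hp'prime hpp' hnoprime
    have hp'2 : 2 ≤ p' := hp'prime.two_le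
    have hp'R : (2 : ℝ) ≤ p' := by exact_mod_cast hp'2
    have hThi' : 2 ^ 80 * θ (p' : ℝ) ≤ ((Thi + Lhi' : ℕ) : ℝ) := by
      rw [hθ']; push_cast; linarith
    have hP' : (((P * p') / (p' - 1) : ℕ) : ℝ) ≤ 2 ^ 80 * piRatio p' := by
      have h1 : (((P * p') / (p' - 1) : ℕ) : ℝ) ≤ ((P * p' : ℕ) : ℝ) / ((p' - 1 : ℕ) : ℝ) :=
        Nat.cast_div_le
      have hsub : ((p' - 1 : ℕ) : ℝ) = (p' : ℝ) - 1 := by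
        rw [Nat.cast_sub (by omega)]; push_cast; ring
      rw [hsub] at h1
      push_cast at h1
      have hden : (0 : ℝ) < (p' : ℝ) - 1 := by linarith
      have h2 : ((P : ℝ) * p') / ((p' : ℝ) - 1) ≤ (2 ^ 80 * piRatio p * p') / ((p' : ℝ) - 1) :=
        div_le_div_of_nonneg_right (mul_le_mul_of_nonneg_right hPle (by positivity)) hden.le
      rw [hPi']
      calc (((P * p') / (p' - 1) : ℕ) : ℝ) ≤ ((P : ℝ) * p') / ((p' : ℝ) - 1) := h1
        _ ≤ (2 ^ 80 * piRatio p * p') / ((p' : ℝ) - 1) := h2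
        _ = 2 ^ 80 * (piRatio p * ((p' : ℝ) / ((p' : ℝ) - 1))) := by ring
    have hnew := nicolasChk_sound hg3 hp'2 hLhi' hThi' hP'
    refine ⟨⟨hp'T, hp'prime, hLlo', hLhi', hThi', hP', ?_⟩, rfl⟩
    intro q hq hqle
    simp only at hqle
    by_cases hqp : q ≤ p
    · exact hnic q hq hqp
    · have hq' : q = p' := by
        by_contra hne
        exact hnoprime q (by omega) (by omega) hq
      rw [hq']
      exact nicolasInequality_of_lt hnew

/-! ### The run -/

/-- **Soundness of a run** along the table cursor. [folklore] -/
private theorem runN_sound : ∀ (fuel : ℕ) {s s' : NS}, Inv s → runN fuel s (after s.p table) = some s' →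
    Inv s'
  | 0, s, s', hI, h => by
      simp only [runN, Option.some.injEq] at h
      exact h ▸ hI
  | fuel + 1, s, s', hI, h => by
      rcases hseg : after s.p table with _ | ⟨p', rest⟩
      · rw [hseg] at h
        simp only [runN, Option.some.injEq] at h
        exact h ▸ hI
      · rw [hseg] at h
        simp only [runN] at h
        rcases hst : stepN s p' with _ | s₁
        · rw [hst] at h; simp at h
        · rw [hst] at h
          simp only at h
          obtain ⟨hI₁, hp₁⟩ := stepN_inv hI hseg hst
          have hrest : rest = after s₁.p table := by
            rw [hp₁]; exact tail_after tableOK.sorted hseg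
          rw [hrest] at h
          exact runN_sound fuel hI₁ h

/-- **Soundness of a chunk**: `runDN` preserves the invariant. [cite: Nicolas1983, Thm. 2 (a)] -/
theorem runDN_sound {fuel : ℕ} {s s' : NS} (hI : Inv s) (h : runDN fuel s = some s') : Inv s' :=
  runN_sound fuel hI h

/-! ### The initial state -/

/-- Nicolas's inequality at `2# = 2`: `e^γ log log 2 < 0 < 2 = 2/φ(2)`. [cite: Nicolas2012, Thm. 1.1 (1.7) (c(2) = 2.2085…)] -/
theorem nicolasInequality_two : nicolasInequality (primorial 2) := by
  rw [primorial_two, nicolasInequality]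
  have hφ : Nat.totient 2 = 1 := by decide
  rw [hφ]
  push_cast
  have hlog2 : Real.log (2 : ℝ) < 1 := by linarith [Real.log_two_lt_d9]
  have hlog2pos : 0 < Real.log (2 : ℝ) := Real.log_pos one_lt_two
  have hneg : Real.log (Real.log (2 : ℝ)) < 0 := Real.log_neg hlog2pos hlog2
  have heγ : 0 < Real.exp Real.eulerMascheroniConstant := Real.exp_pos _
  nlinarith

/-- **The initial state satisfies the invariant.** [cite: Nicolas1983, Thm. 2 (a)] -/
theorem initN_inv : Inv initN := by
  refine ⟨tableOK.two_mem, Nat.prime_two, ?_, ?_, ?_, ?_, ?_⟩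
  · simpa [initN] using L2LON_le
  · simpa [initN] using le_L2HIN
  · simp only [initN]; push_cast; rw [theta_two]; exact le_L2HIN
  · simp only [initN, Nat.mul_eq]; push_cast; rw [piRatio_two, SC_real]; norm_num
  · intro q hq hq2
    simp only [initN] at hq2
    have : q = 2 := le_antisymm hq2 hq.two_le
    subst this
    exact nicolasInequality_two

/-- **Nicolas's inequality from a finished run**: if the invariant holds at a state with prime `P`,
then `e^γ log log(q#) < q#/φ(q#)` for every prime `q ≤ P`. [cite: Nicolas1983, Thm. 2 (a)] -/
theorem nicolasInequality_of_inv {s : NS} (hI : Inv s) {q : ℕ} (hq : q.Prime) (hle : q ≤ s.p) :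
    nicolasInequality (primorial q) :=
  hI.nic q hq hle

end Literature.NumberTheory.LFunctions.NicolasChain

end
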